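import Literature.Computability.Complexity.TM2AnyList
import HarnessLib

/-!
# Running a transducer over every entry of a computed list and concatenating the outputs (TM2)

Trunk `CplxCore`, toolkit for `TimeBounds.lean` (siblings: `TimeBoundsProofs.lean`, sequential
composition; `TM2Iterate.lean`, clocked iteration; `TM2Simulation.lean`, statement lifting;
`TM2Disjunction.lean` / `TM2AnyList.lean`, disjunction of deciders). Main result:

* `Turing.TM2ComputableAux.flatMapMachine M₁ M₂ sep` and
  `Turing.TM2ComputableAux.flatMap_outputsWithin`: let `M₁ : TM2ComputableAux Γ₀ Γ₁` map the
  word `l` to the `sep`-terminated concatenation `bs.flatMap (fun b => w b ++ [sep])` of words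
  `w b` not containing the separator `sep`, within `m₁` steps, and let
  `M₂ : TM2ComputableAux Γ₁ Γ₂` map each `w b`, `b ∈ bs`, to the word `y b` within `m b` steps.
  Then `M₁.flatMapMachine M₂ sep` maps `l` to the concatenation `bs.flatMap y` within
  `m₁ + Σ_{b ∈ bs} (m b + 2 |w b| + 2 |y b| + 3) + 2` steps.

This is the machine-level closure property "run a subroutine on each item of a list written on a
work tape and write the results one after the other" (Arora–Barak 2009, §1.3: multi-tape
machines running machines as subroutines; Claim 1.6), with *additive* running time; the
decision version (OR of one answer bit per entry) is `TM2AnyList.lean`. It turns a machine for a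
map `ψ ↦ F ψ` producing blank-terminated lists (such as the reductions of one formula in
Impagliazzo–Paturi 2001, Lemma 2) into a machine for `l ↦ l.flatMap F` on blank-terminated
lists. Nothing of this is in Mathlib.

## The machine (`TM2FlatMap.fmTM`)

Given bundled machines `M₁ M₂ : Turing.FinTM2`, identifications `o₁ : M₁.Γ M₁.k₁ ≃ B` of the
output alphabet of `M₁` with the list alphabet `B`, `e₂ : M₂.Γ M₂.k₀ ≃ B`, `o₂ : M₂.Γ M₂.k₁ ≃ C`
with the output alphabet `C`, and the separator `sep : B`, the machine has stacks
`(M₁.K ⊕ M₂.K) ⊕ Bool` (two auxiliary stacks: the transfer stack `TMP = inr false` of alphabet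
`B` and the accumulator `ACC = inr true` of alphabet `C`; its input stack is the input stack of
`M₁`, its output stack the output stack of `M₂`), labels `(M₁.Λ ⊕ M₂.Λ) ⊕ Ctrl` with four
control labels, and states `M₁.σ × M₂.σ × Option B × Option C` (registers for one symbol of
each kind in transit). Control flow (`TM2FlatMap.ctrlStmt`):

* the statements of `M₁` (lifted along `inl ∘ inl` by `TM2Lift.liftStmt`, `halt ↦ goto next`):
  started in Mathlib's `initList` form, `M₁` halts in `haltList` form, i.e. at `next` the list
  word sits on its output stack and its other stacks are empty;
* `next`: pop the output stack of `M₁`; if it is empty go to `fin`; if the symbol is `sep` go to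
  `pour`; otherwise push the symbol on `TMP` (the current entry is collected in reverse);
* `pour`: pour `TMP` onto the input stack of `M₂` (restoring the order) and jump to `M₂.main`;
  the statements of `M₂` are lifted along `inl ∘ inr` with `halt ↦ goto collect`; at `collect`
  the output stack of `M₂` holds the output word, its other stacks are empty and its state is
  reset (`haltList` form): `collect` pours that word onto `ACC` (reversed, so that `ACC` holds
  the reverse of the concatenation of the outputs so far) and returns to `next`;
* `fin`: pour `ACC` back onto the (empty) output stack of `M₂` (restoring the order), reset the
  state, halt — Mathlib's `haltList` convention.

## Proof architecture

As in `TM2AnyList.lean` (whose `listWord`, `update_bot_nil` are reused): configurations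
`TM2FlatMap.cfg`, stack bookkeeping `TM2FlatMap.mkStk` with `Function.update` lemmas, one-step
lemmas of the control labels by `simp`, the phases
`next_word` (induction on the entry, using `sep ∉ w b`), `pour_run`, `collect_run`, `fin_run`,
runs of `M₁`, `M₂` transported by `TM2Lift.iterate_lift` (`embeds₁_iff`, `embeds₂_iff`), the
main loop `loop_run` by induction on the list, all chained with `TM2Iter.ReachesIn`.

## References

* S. Arora, B. Barak, *Computational Complexity: A Modern Approach*, CUP 2009, §1.3 (machine
  constructions: subroutines on multi-tape machines), Claim 1.6. doi:10.1017/cbo9780511804090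
* R. Impagliazzo, R. Paturi, *On the complexity of k-SAT*, JCSS 62 (2001), proof of Lemma 2
  and Theorem 3 (the application: a reduction applied to every formula of a computed list).
* Mathlib, `Mathlib/Computability/TuringMachine/Computable.lean` (`FinTM2`, `initList`,
  `haltList`, `TM2OutputsInTime`).
-/

namespace Literature.Computability.Complexity.TM2FlatMap

open Turing StateTransition Function TM2Comp TM2Iter TM2Lift
open TM2Any (update_bot_nil listWord listWord_cons)

/-! ### Control labels, alphabets, states -/

/-- The control labels of the machine (besides the labels of the two machines). [folklore] -/
inductive Ctrl
  | next
  | pour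
  | collect
  | fin
  deriving DecidableEq, Fintype

section Machine

variable {K₁ K₂ : Type} {G₁ : K₁ → Type} {G₂ : K₂ → Type} {Λ₁ Λ₂ σ₁ σ₂ B C : Type}

/-- Stack alphabets: those of `M₁` on `inl ∘ inl`, those of `M₂` on `inl ∘ inr`, the list
alphabet `B` on the transfer stack `inr false` and the output alphabet `C` on the accumulator
`inr true`. Written with `casesOn` so that it unfolds by `rfl` on constructors. [folklore] -/
abbrev FMΓ (G₁ : K₁ → Type) (G₂ : K₂ → Type) (B C : Type) : (K₁ ⊕ K₂) ⊕ Bool → Type := fun j =>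
  Sum.casesOn (motive := fun _ => Type) j
    (fun j' => Sum.casesOn (motive := fun _ => Type) j' G₁ G₂) (fun b => Bool.casesOn b B C)

/-- Internal states: the states of the two machines and registers for one symbol of the list
alphabet and one symbol of the output alphabet in transit (`none` between steps). [folklore] -/
abbrev St (σ₁ σ₂ B C : Type) : Type := σ₁ × σ₂ × Option B × Option C

/-- The lens of the composite states onto the states of `M₁`. [folklore] -/
def set₁ (v : St σ₁ σ₂ B C) (s : σ₁) : St σ₁ σ₂ B C := (s, v.2)

/-- The lens of the composite states onto the states of `M₂`. [folklore] -/
def set₂ (v : St σ₁ σ₂ B C) (s : σ₂) : St σ₁ σ₂ B C := (v.1, s, v.2.2)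

/-- `set₁` is a lawful lens. [folklore] -/
theorem lens₁ : LawfulLens (fun v : St σ₁ σ₂ B C => v.1) set₁ :=
  ⟨fun _ _ => rfl, fun _ _ _ => rfl, fun _ => rfl⟩

/-- `set₂` is a lawful lens. [folklore] -/
theorem lens₂ : LawfulLens (fun v : St σ₁ σ₂ B C => v.2.1) set₂ :=
  ⟨fun _ _ => rfl, fun _ _ _ => rfl, fun _ => rfl⟩

/-- Extract the list symbol in transit (junk value `default` if there is none). [folklore] -/
def rget [Inhabited B] (v : St σ₁ σ₂ B C) : B := v.2.2.1.getD default

/-- Extract the output symbol in transit (junk value `default` if there is none). [folklore] -/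
def cget [Inhabited C] (v : St σ₁ σ₂ B C) : C := v.2.2.2.getD default

/-- Reset both symbol registers. [folklore] -/
def rst (v : St σ₁ σ₂ B C) : St σ₁ σ₂ B C := (v.1, v.2.1, none, none)

/-- Stack contents from the stacks `S₁` of `M₁`, `S₂` of `M₂`, the content `t` of `TMP` and the
content `a` of `ACC`. [folklore] -/
def mkStk (S₁ : ∀ k, List (G₁ k)) (S₂ : ∀ k, List (G₂ k)) (t : List B) (a : List C) :
    ∀ j : (K₁ ⊕ K₂) ⊕ Bool, List (FMΓ G₁ G₂ B C j)
  | Sum.inl (Sum.inl k) => S₁ k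
  | Sum.inl (Sum.inr k) => S₂ k
  | Sum.inr false => t
  | Sum.inr true => a

section StkLemmas

variable (S₁ : ∀ k, List (G₁ k)) (S₂ : ∀ k, List (G₂ k)) (t : List B) (a : List C)

/-- Reading a stack of `M₁`. [folklore] -/
@[simp] theorem mkStk_inl_inl (k : K₁) : mkStk S₁ S₂ t a (Sum.inl (Sum.inl k)) = S₁ k := rfl
/-- Reading a stack of `M₂`. [folklore] -/
@[simp] theorem mkStk_inl_inr (k : K₂) : mkStk S₁ S₂ t a (Sum.inl (Sum.inr k)) = S₂ k := rfl
/-- Reading `TMP`. [folklore] -/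
@[simp] theorem mkStk_TMP : mkStk S₁ S₂ t a (Sum.inr false) = t := rfl
/-- Reading `ACC`. [folklore] -/
@[simp] theorem mkStk_ACC : mkStk S₁ S₂ t a (Sum.inr true) = a := rfl

variable {dK : DecidableEq ((K₁ ⊕ K₂) ⊕ Bool)}

/-- Writing a stack of `M₁` (any decidability instance, so that the lemma also fires on the
instance bundled in a `FinTM2`). [folklore] -/
@[simp] theorem mkStk_update_inl_inl [DecidableEq K₁] (k : K₁) (L : List (G₁ k)) :
    @update _ _ dK (mkStk S₁ S₂ t a) (Sum.inl (Sum.inl k)) L = mkStk (update S₁ k L) S₂ t a := by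
  funext j
  rcases j with (k' | k') | (_ | _)
  · rcases eq_or_ne k' k with rfl | h
    · simp
    · rw [update_of_ne (by simpa using h)]; simp [update_of_ne h]
  · rw [update_of_ne (by simp)]; rfl
  · rw [update_of_ne (by simp)]; rfl
  · rw [update_of_ne (by simp)]; rfl

/-- Writing a stack of `M₂`. [folklore] -/
@[simp] theorem mkStk_update_inl_inr [DecidableEq K₂] (k : K₂) (L : List (G₂ k)) :
    @update _ _ dK (mkStk S₁ S₂ t a) (Sum.inl (Sum.inr k)) L = mkStk S₁ (update S₂ k L) t a := by
  funext j
  rcases j with (k' | k') | (_ | _)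
  · rw [update_of_ne (by simp)]; rfl
  · rcases eq_or_ne k' k with rfl | h
    · simp
    · rw [update_of_ne (by simpa using h)]; simp [update_of_ne h]
  · rw [update_of_ne (by simp)]; rfl
  · rw [update_of_ne (by simp)]; rfl

/-- Writing `TMP`. [folklore] -/
@[simp] theorem mkStk_update_TMP (t' : List B) :
    @update _ _ dK (mkStk S₁ S₂ t a) (Sum.inr false) t' = mkStk S₁ S₂ t' a := by
  funext j
  rcases j with (k' | k') | (_ | _)
  · rw [update_of_ne (by simp)]; rfl
  · rw [update_of_ne (by simp)]; rfl
  · simp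
  · rw [update_of_ne (by simp)]; rfl

/-- Writing `ACC`. [folklore] -/
@[simp] theorem mkStk_update_ACC (a' : List C) :
    @update _ _ dK (mkStk S₁ S₂ t a) (Sum.inr true) a' = mkStk S₁ S₂ t a' := by
  funext j
  rcases j with (k' | k') | (_ | _)
  · rw [update_of_ne (by simp)]; rfl
  · rw [update_of_ne (by simp)]; rfl
  · rw [update_of_ne (by simp)]; rfl
  · simp

/-- The empty stack assignment. [folklore] -/
theorem mkStk_bot : mkStk (B := B) (C := C) (fun k => ([] : List (G₁ k)))
    (fun k => ([] : List (G₂ k))) [] [] = fun j => ([] : List (FMΓ G₁ G₂ B C j)) := by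
  funext j
  rcases j with (k | k) | (_ | _) <;> rfl

end StkLemmas

variable [Inhabited B] [Inhabited C] [DecidableEq B] (k₁₁ : K₁) (k₀₂ k₁₂ : K₂) (o₁ : G₁ k₁₁ ≃ B)
  (e₂ : G₂ k₀₂ ≃ B) (o₂ : G₂ k₁₂ ≃ C) (sep : B) (main₂ : Λ₂) (init₁ : σ₁) (init₂ : σ₂)

/-- The control statements.
* `next`: pop the output stack of `M₁` (read through `o₁`): empty ↦ `fin`; the separator ↦
  `pour`; another symbol ↦ push it on `TMP` and repeat;
* `pour`: pour `TMP` onto the input stack of `M₂` (through `e₂.symm`), then start `M₂`;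
* `collect`: pour the output stack of `M₂` (read through `o₂`) onto `ACC`, then go to `next`;
* `fin`: pour `ACC` onto the output stack of `M₂` (through `o₂.symm`); when done reset the
  state and halt.
The symbol registers are reset before every jump. [folklore] -/
def ctrlStmt : Ctrl → TM2.Stmt (FMΓ G₁ G₂ B C) ((Λ₁ ⊕ Λ₂) ⊕ Ctrl) (St σ₁ σ₂ B C)
  | Ctrl.next =>
      TM2.Stmt.pop (Sum.inl (Sum.inl k₁₁)) (fun v a => (v.1, v.2.1, a.map o₁, v.2.2.2)) <|
        TM2.Stmt.branch (fun v => v.2.2.1.isNone)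
          (TM2.Stmt.load rst <| TM2.Stmt.goto fun _ => Sum.inr Ctrl.fin) <|
          TM2.Stmt.branch (fun v => decide (v.2.2.1 = some sep))
            (TM2.Stmt.load rst <| TM2.Stmt.goto fun _ => Sum.inr Ctrl.pour)
            (TM2.Stmt.push (Sum.inr false) (fun v => rget v) <| TM2.Stmt.load rst <|
              TM2.Stmt.goto fun _ => Sum.inr Ctrl.next)
  | Ctrl.pour =>
      TM2.Stmt.pop (Sum.inr false) (fun v a => (v.1, v.2.1, a, v.2.2.2)) <|
        TM2.Stmt.branch (fun v => v.2.2.1.isNone)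
          (TM2.Stmt.load rst <| TM2.Stmt.goto fun _ => Sum.inl (Sum.inr main₂))
          (TM2.Stmt.push (Sum.inl (Sum.inr k₀₂)) (fun v => e₂.symm (rget v)) <|
            TM2.Stmt.load rst <| TM2.Stmt.goto fun _ => Sum.inr Ctrl.pour)
  | Ctrl.collect =>
      TM2.Stmt.pop (Sum.inl (Sum.inr k₁₂)) (fun v a => (v.1, v.2.1, v.2.2.1, a.map o₂)) <|
        TM2.Stmt.branch (fun v => v.2.2.2.isNone)
          (TM2.Stmt.load rst <| TM2.Stmt.goto fun _ => Sum.inr Ctrl.next)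
          (TM2.Stmt.push (Sum.inr true) (fun v => cget v) <| TM2.Stmt.load rst <|
            TM2.Stmt.goto fun _ => Sum.inr Ctrl.collect)
  | Ctrl.fin =>
      TM2.Stmt.pop (Sum.inr true) (fun v a => (v.1, v.2.1, v.2.2.1, a)) <|
        TM2.Stmt.branch (fun v => v.2.2.2.isNone)
          (TM2.Stmt.load (fun _ => (init₁, init₂, none, none)) TM2.Stmt.halt)
          (TM2.Stmt.push (Sum.inl (Sum.inr k₁₂)) (fun v => o₂.symm (cget v)) <|
            TM2.Stmt.load rst <| TM2.Stmt.goto fun _ => Sum.inr Ctrl.fin)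

end Machine

/-! ### Bundling: the machine as a `FinTM2` -/

section Bundled

variable (M₁ M₂ : FinTM2) (B C : Type)

/-- Configurations, from the label, the two machine states, the two registers, the stacks of the
two machines, the transfer stack and the accumulator. [folklore] -/
def cfg (l : Option ((M₁.Λ ⊕ M₂.Λ) ⊕ Ctrl)) (v₁ : M₁.σ) (v₂ : M₂.σ) (r : Option B) (q : Option C)
    (S₁ : ∀ k, List (M₁.Γ k)) (S₂ : ∀ k, List (M₂.Γ k)) (t : List B) (a : List C) :
    TM2.Cfg (FMΓ M₁.Γ M₂.Γ B C) ((M₁.Λ ⊕ M₂.Λ) ⊕ Ctrl) (St M₁.σ M₂.σ B C) :=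
  ⟨l, (v₁, v₂, r, q), mkStk S₁ S₂ t a⟩

/-- The (unbundled) type of configurations. [folklore] -/
abbrev ACfg : Type := TM2.Cfg (FMΓ M₁.Γ M₂.Γ B C) ((M₁.Λ ⊕ M₂.Λ) ⊕ Ctrl) (St M₁.σ M₂.σ B C)

variable {B C} [Inhabited B] [Inhabited C] [DecidableEq B] [Fintype C] (o₁ : M₁.Γ M₁.k₁ ≃ B)
  (e₂ : M₂.Γ M₂.k₀ ≃ B) (o₂ : M₂.Γ M₂.k₁ ≃ C) (sep : B)

/-- The program: lifted statements of `M₁` (halt ↦ `next`), lifted statements of `M₂`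
(halt ↦ `collect`), control statements. [folklore] -/
def fmStmt : (M₁.Λ ⊕ M₂.Λ) ⊕ Ctrl →
    TM2.Stmt (FMΓ M₁.Γ M₂.Γ B C) ((M₁.Λ ⊕ M₂.Λ) ⊕ Ctrl) (St M₁.σ M₂.σ B C)
  | Sum.inl (Sum.inl l) =>
      liftStmt (Γ' := FMΓ M₁.Γ M₂.Γ B C) (fun k => Sum.inl (Sum.inl k))
        (fun l => Sum.inl (Sum.inl l)) (some (Sum.inr Ctrl.next)) (fun v => v.1) set₁ (M₁.m l)
  | Sum.inl (Sum.inr l) =>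
      liftStmt (Γ' := FMΓ M₁.Γ M₂.Γ B C) (fun k => Sum.inl (Sum.inr k))
        (fun l => Sum.inl (Sum.inr l)) (some (Sum.inr Ctrl.collect)) (fun v => v.2.1) set₂
        (M₂.m l)
  | Sum.inr c => ctrlStmt M₁.k₁ M₂.k₀ M₂.k₁ o₁ e₂ o₂ sep M₂.main M₁.initialState
      M₂.initialState c

/-- The machine running `M₂` on every `sep`-terminated entry of the output of `M₁` and
concatenating the output words: stacks `(M₁.K ⊕ M₂.K) ⊕ Bool` (input stack `inl (inl M₁.k₀)`,
output stack `inl (inr M₂.k₁)`), labels `(M₁.Λ ⊕ M₂.Λ) ⊕ Ctrl` (main label: that of `M₁`),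
states `M₁.σ × M₂.σ × Option B × Option C`.
[cite: AroraBarak2009, §1.3 (multi-tape machine constructions; subroutines)] -/
noncomputable def fmTM : FinTM2 :=
  letI := M₁.kFin; letI := M₁.ΛFin; letI := M₁.σFin
  letI := M₂.kFin; letI := M₂.ΛFin; letI := M₂.σFin; letI := M₂.Γk₀Fin
  letI : Fintype B := Fintype.ofEquiv _ e₂
  { K := (M₁.K ⊕ M₂.K) ⊕ Bool
    k₀ := Sum.inl (Sum.inl M₁.k₀)
    k₁ := Sum.inl (Sum.inr M₂.k₁)
    Γ := FMΓ M₁.Γ M₂.Γ B C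
    Λ := (M₁.Λ ⊕ M₂.Λ) ⊕ Ctrl
    main := Sum.inl (Sum.inl M₁.main)
    σ := St M₁.σ M₂.σ B C
    initialState := (M₁.initialState, M₂.initialState, none, none)
    Γk₀Fin := M₁.Γk₀Fin
    m := fmStmt M₁ M₂ o₁ e₂ o₂ sep }

/-- A step at a control label, unbundled. [folklore] -/
theorem step_inr (c : Ctrl) (var : St M₁.σ M₂.σ B C) (stk : ∀ j, List (FMΓ M₁.Γ M₂.Γ B C j)) :
    (fmTM M₁ M₂ o₁ e₂ o₂ sep).step (⟨some (Sum.inr c), var, stk⟩ : ACfg M₁ M₂ B C) =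
      some (TM2.stepAux (ctrlStmt M₁.k₁ M₂.k₀ M₂.k₁ o₁ e₂ o₂ sep M₂.main M₁.initialState
        M₂.initialState c) var stk) :=
  rfl

/-! ### Single steps of the control labels -/

section Steps

variable (v₁ : M₁.σ) (v₂ : M₂.σ) (S₁ : ∀ k, List (M₁.Γ k)) (S₂ : ∀ k, List (M₂.Γ k))
  (t : List B) (a : List C)

/-- `next` on the exhausted list: proceed to `fin`. [folklore] -/
theorem step_next_nil :
    (fmTM M₁ M₂ o₁ e₂ o₂ sep).step (cfg M₁ M₂ B C (some (Sum.inr Ctrl.next)) v₁ v₂ none none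
        (update S₁ M₁.k₁ []) S₂ t a) =
      some (cfg M₁ M₂ B C (some (Sum.inr Ctrl.fin)) v₁ v₂ none none (update S₁ M₁.k₁ []) S₂
        t a) := by
  rw [cfg, step_inr]; simp [ctrlStmt, rst, cfg]

/-- `next` on the separator: proceed to `pour`. [folklore] -/
theorem step_next_sep (L : List (M₁.Γ M₁.k₁)) :
    (fmTM M₁ M₂ o₁ e₂ o₂ sep).step (cfg M₁ M₂ B C (some (Sum.inr Ctrl.next)) v₁ v₂ none none
        (update S₁ M₁.k₁ (o₁.symm sep :: L)) S₂ t a) =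
      some (cfg M₁ M₂ B C (some (Sum.inr Ctrl.pour)) v₁ v₂ none none (update S₁ M₁.k₁ L) S₂
        t a) := by
  rw [cfg, step_inr]; simp [ctrlStmt, rst, cfg]

/-- `next` on an ordinary symbol: move it to `TMP`. [folklore] -/
theorem step_next_ne {s : B} (hs : s ≠ sep) (L : List (M₁.Γ M₁.k₁)) :
    (fmTM M₁ M₂ o₁ e₂ o₂ sep).step (cfg M₁ M₂ B C (some (Sum.inr Ctrl.next)) v₁ v₂ none none
        (update S₁ M₁.k₁ (o₁.symm s :: L)) S₂ t a) =
      some (cfg M₁ M₂ B C (some (Sum.inr Ctrl.next)) v₁ v₂ none none (update S₁ M₁.k₁ L) S₂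
        (s :: t) a) := by
  rw [cfg, step_inr]; simp [ctrlStmt, rst, rget, cfg, hs]

/-- `pour` on nonempty `TMP`: push one symbol on the input stack of `M₂`. [folklore] -/
theorem step_pour_cons (s : B) :
    (fmTM M₁ M₂ o₁ e₂ o₂ sep).step (cfg M₁ M₂ B C (some (Sum.inr Ctrl.pour)) v₁ v₂ none none
        S₁ S₂ (s :: t) a) =
      some (cfg M₁ M₂ B C (some (Sum.inr Ctrl.pour)) v₁ v₂ none none S₁
        (update S₂ M₂.k₀ (e₂.symm s :: S₂ M₂.k₀)) t a) := by
  rw [cfg, step_inr]; simp [ctrlStmt, rst, rget, cfg]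

/-- `pour` on empty `TMP`: jump to the main label of `M₂`. [folklore] -/
theorem step_pour_nil :
    (fmTM M₁ M₂ o₁ e₂ o₂ sep).step (cfg M₁ M₂ B C (some (Sum.inr Ctrl.pour)) v₁ v₂ none none
        S₁ S₂ [] a) =
      some (cfg M₁ M₂ B C (some (Sum.inl (Sum.inr M₂.main))) v₁ v₂ none none S₁ S₂ [] a) := by
  rw [cfg, step_inr]; simp [ctrlStmt, rst, cfg]

/-- `collect` on a nonempty output stack of `M₂`: move one symbol to `ACC`. [folklore] -/
theorem step_collect_cons (c : C) (L : List (M₂.Γ M₂.k₁)) :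
    (fmTM M₁ M₂ o₁ e₂ o₂ sep).step (cfg M₁ M₂ B C (some (Sum.inr Ctrl.collect)) v₁ v₂ none
        none S₁ (update S₂ M₂.k₁ (o₂.symm c :: L)) t a) =
      some (cfg M₁ M₂ B C (some (Sum.inr Ctrl.collect)) v₁ v₂ none none
        S₁ (update S₂ M₂.k₁ L) t (c :: a)) := by
  rw [cfg, step_inr]; simp [ctrlStmt, rst, cget, cfg]

/-- `collect` on the empty output stack of `M₂`: go to `next`. [folklore] -/
theorem step_collect_nil :
    (fmTM M₁ M₂ o₁ e₂ o₂ sep).step (cfg M₁ M₂ B C (some (Sum.inr Ctrl.collect)) v₁ v₂ none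
        none S₁ (update S₂ M₂.k₁ []) t a) =
      some (cfg M₁ M₂ B C (some (Sum.inr Ctrl.next)) v₁ v₂ none none
        S₁ (update S₂ M₂.k₁ []) t a) := by
  rw [cfg, step_inr]; simp [ctrlStmt, rst, cfg]

/-- `fin` on nonempty `ACC`: move one symbol to the output stack of `M₂`. [folklore] -/
theorem step_fin_cons (c : C) (L : List (M₂.Γ M₂.k₁)) :
    (fmTM M₁ M₂ o₁ e₂ o₂ sep).step (cfg M₁ M₂ B C (some (Sum.inr Ctrl.fin)) v₁ v₂ none none
        S₁ (update S₂ M₂.k₁ L) t (c :: a)) =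
      some (cfg M₁ M₂ B C (some (Sum.inr Ctrl.fin)) v₁ v₂ none none
        S₁ (update S₂ M₂.k₁ (o₂.symm c :: L)) t a) := by
  rw [cfg, step_inr]; simp [ctrlStmt, rst, cget, cfg]

/-- `fin` on empty `ACC`: reset the state and halt. [folklore] -/
theorem step_fin_nil :
    (fmTM M₁ M₂ o₁ e₂ o₂ sep).step (cfg M₁ M₂ B C (some (Sum.inr Ctrl.fin)) v₁ v₂ none none
        S₁ S₂ t []) =
      some (cfg M₁ M₂ B C none M₁.initialState M₂.initialState none none S₁ S₂ t []) := by
  rw [cfg, step_inr]; simp [ctrlStmt, cfg]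

end Steps

/-! ### Phases -/

section Phases

variable (v₁ : M₁.σ) (v₂ : M₂.σ) (S₁ : ∀ k, List (M₁.Γ k)) (S₂ : ∀ k, List (M₂.Γ k))

/-- `next`, one entry: a word `w` without separator followed by `sep` is moved (reversed) from the
output stack of `M₁` onto `TMP`, the separator is consumed, and the machine proceeds to `pour`.
[folklore] -/
theorem next_word (w : List B) (hw : sep ∉ w) (L : List (M₁.Γ M₁.k₁)) (t : List B) (a : List C) :
    ReachesIn (C := ACfg M₁ M₂ B C) (fmTM M₁ M₂ o₁ e₂ o₂ sep).step
      (cfg M₁ M₂ B C (some (Sum.inr Ctrl.next)) v₁ v₂ none none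
        (update S₁ M₁.k₁ (w.map o₁.symm ++ o₁.symm sep :: L)) S₂ t a)
      (cfg M₁ M₂ B C (some (Sum.inr Ctrl.pour)) v₁ v₂ none none (update S₁ M₁.k₁ L) S₂
        (w.reverse ++ t) a)
      (w.length + 1) := by
  induction w generalizing t with
  | nil => simpa using ReachesIn.single (step_next_sep M₁ M₂ o₁ e₂ o₂ sep v₁ v₂ S₁ S₂ t a L)
  | cons s w ih =>
    have hs : s ≠ sep := fun h => hw (h ▸ List.mem_cons_self)
    have hw' : sep ∉ w := fun h => hw (List.mem_cons_of_mem _ h)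
    have h1 := step_next_ne M₁ M₂ o₁ e₂ o₂ sep v₁ v₂ S₁ S₂ t a hs (w.map o₁.symm ++ o₁.symm sep :: L)
    have h2 := ih hw' (s :: t)
    simpa [List.append_assoc] using ReachesIn.step_trans h1 h2

/-- `pour`: `TMP` is poured (reversed, through `e₂.symm`) on top of the input stack of `M₂`, then
the machine jumps to the main label of `M₂`. [folklore] -/
theorem pour_run (t : List B) (a : List C) :
    ReachesIn (C := ACfg M₁ M₂ B C) (fmTM M₁ M₂ o₁ e₂ o₂ sep).step
      (cfg M₁ M₂ B C (some (Sum.inr Ctrl.pour)) v₁ v₂ none none S₁ S₂ t a)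
      (cfg M₁ M₂ B C (some (Sum.inl (Sum.inr M₂.main))) v₁ v₂ none none S₁
        (update S₂ M₂.k₀ (t.reverse.map e₂.symm ++ S₂ M₂.k₀)) [] a)
      (t.length + 1) := by
  induction t generalizing S₂ with
  | nil =>
    simpa using ReachesIn.single (step_pour_nil M₁ M₂ o₁ e₂ o₂ sep v₁ v₂ S₁ S₂ a)
  | cons s t ih =>
    have := ih (update S₂ M₂.k₀ (e₂.symm s :: S₂ M₂.k₀))
    rw [update_idem, update_self] at this
    simpa [List.append_assoc] using
      ReachesIn.step_trans (step_pour_cons M₁ M₂ o₁ e₂ o₂ sep v₁ v₂ S₁ S₂ t a s) this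

/-- `collect`: the output word `y` of `M₂` is poured (reversed) onto `ACC`, then the machine
proceeds to `next`. [folklore] -/
theorem collect_run (y : List C) (t : List B) (a : List C) :
    ReachesIn (C := ACfg M₁ M₂ B C) (fmTM M₁ M₂ o₁ e₂ o₂ sep).step
      (cfg M₁ M₂ B C (some (Sum.inr Ctrl.collect)) v₁ v₂ none none S₁
        (update S₂ M₂.k₁ (y.map o₂.symm)) t a)
      (cfg M₁ M₂ B C (some (Sum.inr Ctrl.next)) v₁ v₂ none none S₁ (update S₂ M₂.k₁ []) t
        (y.reverse ++ a))
      (y.length + 1) := by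
  induction y generalizing a with
  | nil => simpa using ReachesIn.single (step_collect_nil M₁ M₂ o₁ e₂ o₂ sep v₁ v₂ S₁ S₂ t a)
  | cons c y ih =>
    have h1 := step_collect_cons M₁ M₂ o₁ e₂ o₂ sep v₁ v₂ S₁ S₂ t a c (y.map o₂.symm)
    have h2 := ih (c :: a)
    simpa [List.append_assoc] using ReachesIn.step_trans h1 h2

/-- `fin`: `ACC` is poured (reversed, through `o₂.symm`) onto the output stack of `M₂`, then the
state is reset and the machine halts. [folklore] -/
theorem fin_run (t : List B) (a : List C) (L : List (M₂.Γ M₂.k₁)) :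
    ReachesIn (C := ACfg M₁ M₂ B C) (fmTM M₁ M₂ o₁ e₂ o₂ sep).step
      (cfg M₁ M₂ B C (some (Sum.inr Ctrl.fin)) v₁ v₂ none none S₁ (update S₂ M₂.k₁ L) t a)
      (cfg M₁ M₂ B C none M₁.initialState M₂.initialState none none S₁
        (update S₂ M₂.k₁ (a.reverse.map o₂.symm ++ L)) t [])
      (a.length + 1) := by
  induction a generalizing L with
  | nil =>
    simpa using ReachesIn.single (step_fin_nil M₁ M₂ o₁ e₂ o₂ sep v₁ v₂ S₁ (update S₂ M₂.k₁ L) t)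
  | cons c a ih =>
    have h1 := step_fin_cons M₁ M₂ o₁ e₂ o₂ sep v₁ v₂ S₁ S₂ t a c L
    have h2 := ih (o₂.symm c :: L)
    simpa [List.append_assoc] using ReachesIn.step_trans h1 h2

end Phases

/-! ### Runs of the two embedded machines -/

section Runs

variable (v₁ : M₁.σ) (v₂ : M₂.σ) (r : Option B) (q : Option C) (S₁ : ∀ k, List (M₁.Γ k))
  (S₂ : ∀ k, List (M₂.Γ k)) (t : List B) (a : List C)

omit [Inhabited B] [Inhabited C] [DecidableEq B] [Fintype C] in
/-- Embedded configurations of `M₁`. [folklore] -/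
theorem embeds₁_iff (c : M₁.Cfg) (c' : ACfg M₁ M₂ B C) :
    Embeds (Γ' := FMΓ M₁.Γ M₂.Γ B C) (fun k => Sum.inl (Sum.inl k)) (fun l => Sum.inl (Sum.inl l))
        (some (Sum.inr Ctrl.next)) set₁ ((v₁, v₂, r, q) : St M₁.σ M₂.σ B C) (mkStk S₁ S₂ t a)
        c c' ↔
      c' = ⟨liftLabel (fun l => Sum.inl (Sum.inl l)) (some (Sum.inr Ctrl.next)) c.l,
        (c.var, v₂, r, q), mkStk c.stk S₂ t a⟩ := by
  constructor
  · rintro ⟨h1, h2, h3, h4⟩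
    obtain ⟨l', w, S'⟩ := c'
    simp only at h1 h2 h3 h4
    subst h1 h2
    congr
    funext j
    rcases j with (k | k) | u
    · exact h3 k
    · exact h4 (Sum.inl (Sum.inr k)) (fun k' h => by simp at h)
    · exact (h4 (Sum.inr u) (fun k' h => by simp at h)).trans (by cases u <;> rfl)
  · rintro rfl
    exact ⟨rfl, rfl, fun k => rfl, fun j hj => by
      rcases j with (k | k) | (_ | _)
      · exact absurd rfl (hj k)
      · rfl
      · rfl
      · rfl⟩

omit [Inhabited B] [Inhabited C] [DecidableEq B] [Fintype C] in
/-- Embedded configurations of `M₂`. [folklore] -/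
theorem embeds₂_iff (c : M₂.Cfg) (c' : ACfg M₁ M₂ B C) :
    Embeds (Γ' := FMΓ M₁.Γ M₂.Γ B C) (fun k => Sum.inl (Sum.inr k)) (fun l => Sum.inl (Sum.inr l))
        (some (Sum.inr Ctrl.collect)) set₂ ((v₁, v₂, r, q) : St M₁.σ M₂.σ B C)
        (mkStk S₁ S₂ t a) c c' ↔
      c' = ⟨liftLabel (fun l => Sum.inl (Sum.inr l)) (some (Sum.inr Ctrl.collect)) c.l,
        (v₁, c.var, r, q), mkStk S₁ c.stk t a⟩ := by
  constructor
  · rintro ⟨h1, h2, h3, h4⟩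
    obtain ⟨l', w, S'⟩ := c'
    simp only at h1 h2 h3 h4
    subst h1 h2
    congr
    funext j
    rcases j with (k | k) | u
    · exact h4 (Sum.inl (Sum.inl k)) (fun k' h => by simp at h)
    · exact h3 k
    · exact (h4 (Sum.inr u) (fun k' h => by simp at h)).trans (by cases u <;> rfl)
  · rintro rfl
    exact ⟨rfl, rfl, fun k => rfl, fun j hj => by
      rcases j with (k | k) | (_ | _)
      · rfl
      · exact absurd rfl (hj k)
      · rfl
      · rfl⟩

omit [Inhabited B] [Inhabited C] [DecidableEq B] [Fintype C] in
/-- `inl ∘ inl` is injective on stack indices. [folklore] -/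
theorem inl_inl_injective :
    Function.Injective (fun k : M₁.K => (Sum.inl (Sum.inl k) : (M₁.K ⊕ M₂.K) ⊕ Bool)) :=
  fun a b h => by simpa using h

omit [Inhabited B] [Inhabited C] [DecidableEq B] [Fintype C] in
/-- `inl ∘ inr` is injective on stack indices. [folklore] -/
theorem inl_inr_injective :
    Function.Injective (fun k : M₂.K => (Sum.inl (Sum.inr k) : (M₁.K ⊕ M₂.K) ⊕ Bool)) :=
  fun a b h => by simpa using h

/-- A run of `M₁` from `initList` to `haltList` is a run of the machine from the main label of
`M₁` to `next`, the rest being untouched. [folklore] -/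
theorem run₁ {n : ℕ} {x : List (M₁.Γ M₁.k₀)} {y : List (M₁.Γ M₁.k₁)}
    (h : (flip bind M₁.step)^[n] (some (initList M₁ x)) = some (haltList M₁ y)) :
    (flip bind (fmTM M₁ M₂ o₁ e₂ o₂ sep).step)^[n]
        (some (cfg M₁ M₂ B C (some (Sum.inl (Sum.inl M₁.main))) M₁.initialState v₂ r q
          (update (fun _ => []) M₁.k₀ x) S₂ t a)) =
      some (cfg M₁ M₂ B C (some (Sum.inr Ctrl.next)) M₁.initialState v₂ r q
        (update (fun _ => []) M₁.k₁ y) S₂ t a) := by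
  have hemb : Embeds (Γ' := FMΓ M₁.Γ M₂.Γ B C) (fun k => Sum.inl (Sum.inl k))
      (fun l => Sum.inl (Sum.inl l)) (some (Sum.inr Ctrl.next)) set₁
      ((M₁.initialState, v₂, r, q) : St M₁.σ M₂.σ B C) (mkStk (fun _ => []) S₂ t a)
      (initList M₁ x)
      (cfg M₁ M₂ B C (some (Sum.inl (Sum.inl M₁.main))) M₁.initialState v₂ r q
        (update (fun _ => []) M₁.k₀ x) S₂ t a) := by
    rw [embeds₁_iff, initList_eq]; rfl
  obtain ⟨d', hd', hdd'⟩ := iterate_lift (Γ' := FMΓ M₁.Γ M₂.Γ B C)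
    (κ := fun k => Sum.inl (Sum.inl k)) (fun l => Sum.inl (Sum.inl l)) (some (Sum.inr Ctrl.next))
    (inl_inl_injective M₁ M₂) lens₁ (m := M₁.m) (m' := fmStmt M₁ M₂ o₁ e₂ o₂ sep)
    (fun l => rfl) n hemb h
  rw [embeds₁_iff, haltList_eq] at hdd'
  rw [hdd'] at hd'
  exact hd'

/-- A run of `M₂` from `initList` to `haltList` is a run of the machine from the main label of
`M₂` to `collect`, the rest being untouched. [folklore] -/
theorem run₂ {n : ℕ} {x : List (M₂.Γ M₂.k₀)} {y : List (M₂.Γ M₂.k₁)}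
    (h : (flip bind M₂.step)^[n] (some (initList M₂ x)) = some (haltList M₂ y)) :
    (flip bind (fmTM M₁ M₂ o₁ e₂ o₂ sep).step)^[n]
        (some (cfg M₁ M₂ B C (some (Sum.inl (Sum.inr M₂.main))) v₁ M₂.initialState r q
          S₁ (update (fun _ => []) M₂.k₀ x) t a)) =
      some (cfg M₁ M₂ B C (some (Sum.inr Ctrl.collect)) v₁ M₂.initialState r q
        S₁ (update (fun _ => []) M₂.k₁ y) t a) := by
  have hemb : Embeds (Γ' := FMΓ M₁.Γ M₂.Γ B C) (fun k => Sum.inl (Sum.inr k))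
      (fun l => Sum.inl (Sum.inr l)) (some (Sum.inr Ctrl.collect)) set₂
      ((v₁, M₂.initialState, r, q) : St M₁.σ M₂.σ B C) (mkStk S₁ (fun _ => []) t a)
      (initList M₂ x)
      (cfg M₁ M₂ B C (some (Sum.inl (Sum.inr M₂.main))) v₁ M₂.initialState r q
        S₁ (update (fun _ => []) M₂.k₀ x) t a) := by
    rw [embeds₂_iff, initList_eq]; rfl
  obtain ⟨d', hd', hdd'⟩ := iterate_lift (Γ' := FMΓ M₁.Γ M₂.Γ B C)
    (κ := fun k => Sum.inl (Sum.inr k)) (fun l => Sum.inl (Sum.inr l))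
    (some (Sum.inr Ctrl.collect))
    (inl_inr_injective M₁ M₂) lens₂ (m := M₂.m) (m' := fmStmt M₁ M₂ o₁ e₂ o₂ sep)
    (fun l => rfl) n hemb h
  rw [embeds₂_iff, haltList_eq] at hdd'
  rw [hdd'] at hd'
  exact hd'

end Runs

/-! ### The main loop and the whole run -/

section Main

variable {β : Type} (w : β → List B) (y : β → List C) (m : β → ℕ)

/-- The cost of the main loop: `m b + 2 |w b| + |y b| + 3` steps per entry. [folklore] -/
def loopCost (bs : List β) : ℕ := (bs.map fun b => m b + 2 * (w b).length + (y b).length + 3).sum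

omit [Inhabited B] [Inhabited C] [DecidableEq B] [Fintype C] in
/-- Unfolding `loopCost` on a nonempty list. [folklore] -/
theorem loopCost_cons (b : β) (bs : List β) :
    loopCost w y m (b :: bs) = m b + 2 * (w b).length + (y b).length + 3 + loopCost w y m bs := by
  simp [loopCost]

omit [Inhabited B] [Inhabited C] [DecidableEq B] [Fintype C] in
/-- The loop cost plus the final pouring of the output is bounded by
`Σ (m b + 2 |w b| + 2 |y b| + 3)`. [folklore] -/
theorem loopCost_add_length_le (bs : List β) :
    loopCost w y m bs + (bs.flatMap y).length ≤
      (bs.map fun b => m b + 2 * (w b).length + 2 * (y b).length + 3).sum := by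
  induction bs with
  | nil => simp [loopCost]
  | cons b bs ih =>
    simp only [loopCost_cons, List.flatMap_cons, List.length_append, List.map_cons,
      List.sum_cons]
    omega

/-- **The main loop.** From `next` with the list word of `bs` on the output stack of `M₁` (all
other stacks of `M₁`, `M₂` empty, `TMP` empty, states reset) and accumulator content `acc`, the
machine reaches `fin` with everything empty and accumulator `(bs.flatMap y).reverse ++ acc`
within `loopCost bs + 1` steps, provided `M₂` maps each `w b` to `y b` within `m b` steps and no
`w b` contains `sep`. [folklore] -/
theorem loop_run (hw : ∀ b, sep ∉ w b)
    (hy : ∀ b, ReachesIn M₂.step (initList M₂ ((w b).map e₂.symm))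
      (haltList M₂ ((y b).map o₂.symm)) (m b)) :
    ∀ (bs : List β) (acc : List C),
      ReachesIn (C := ACfg M₁ M₂ B C) (fmTM M₁ M₂ o₁ e₂ o₂ sep).step
        (cfg M₁ M₂ B C (some (Sum.inr Ctrl.next)) M₁.initialState M₂.initialState none none
          (update (fun _ => []) M₁.k₁ ((listWord sep w bs).map o₁.symm)) (fun _ => []) [] acc)
        (cfg M₁ M₂ B C (some (Sum.inr Ctrl.fin)) M₁.initialState M₂.initialState none none
          (update (fun _ => []) M₁.k₁ []) (update (fun _ => []) M₂.k₁ []) []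
          ((bs.flatMap y).reverse ++ acc))
        (loopCost w y m bs + 1) := by
  intro bs
  induction bs with
  | nil =>
    intro acc
    have := ReachesIn.single (step_next_nil M₁ M₂ o₁ e₂ o₂ sep M₁.initialState M₂.initialState
      (fun _ => []) (fun _ => []) [] acc)
    simpa [listWord, loopCost, update_bot_nil] using this
  | cons b₀ bs ih =>
    intro acc
    -- next: collect the entry `w b₀` on `TMP`
    have s1 := next_word M₁ M₂ o₁ e₂ o₂ sep M₁.initialState M₂.initialState (fun _ => [])
      (fun _ => []) (w b₀) (hw b₀) ((listWord sep w bs).map o₁.symm) [] acc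
    -- pour it onto the input stack of `M₂`
    have s2 := pour_run M₁ M₂ o₁ e₂ o₂ sep M₁.initialState M₂.initialState
      (update (fun _ => []) M₁.k₁ ((listWord sep w bs).map o₁.symm)) (fun _ => [])
      ((w b₀).reverse ++ []) acc
    simp only [List.append_nil, List.reverse_reverse, List.length_reverse] at s1 s2
    -- run `M₂`
    obtain ⟨n, hn, r⟩ := hy b₀
    have s3 : ReachesIn (C := ACfg M₁ M₂ B C) (fmTM M₁ M₂ o₁ e₂ o₂ sep).step _ _ n :=
      ⟨n, le_rfl, run₂ M₁ M₂ o₁ e₂ o₂ sep M₁.initialState none none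
        (update (fun _ => []) M₁.k₁ ((listWord sep w bs).map o₁.symm)) [] acc r⟩
    -- collect the output word on `ACC`
    have s4 := collect_run M₁ M₂ o₁ e₂ o₂ sep M₁.initialState M₂.initialState
      (update (fun _ => []) M₁.k₁ ((listWord sep w bs).map o₁.symm)) (fun _ => []) (y b₀) [] acc
    rw [update_bot_nil] at s4
    -- the remaining entries
    have s5 := ih ((y b₀).reverse ++ acc)
    have := (((s1.trans s2).trans (s3.mono hn)).trans s4).trans s5
    rw [listWord_cons, List.map_append, List.map_cons, loopCost_cons]
    have hacc : ((bs.flatMap y).reverse ++ ((y b₀).reverse ++ acc)) =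
        (((b₀ :: bs).flatMap y).reverse ++ acc) := by
      simp [List.flatMap_cons, List.reverse_append]
    rw [hacc] at this
    refine this.mono ?_
    omega

/-- The initial configuration of the machine: that of `M₁`, embedded. [folklore] -/
theorem initList_fmTM (x : List (M₁.Γ M₁.k₀)) :
    initList (fmTM M₁ M₂ o₁ e₂ o₂ sep) x =
      cfg M₁ M₂ B C (some (Sum.inl (Sum.inl M₁.main))) M₁.initialState M₂.initialState none none
        (update (fun _ => []) M₁.k₀ x) (fun _ => []) [] [] := by
  rw [initList_eq]
  change (⟨some (Sum.inl (Sum.inl M₁.main)), (M₁.initialState, M₂.initialState, none, none),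
      update (fun j => ([] : List (FMΓ M₁.Γ M₂.Γ B C j))) (Sum.inl (Sum.inl M₁.k₀)) x⟩ :
      ACfg M₁ M₂ B C) = _
  rw [← mkStk_bot, mkStk_update_inl_inl]
  rfl

/-- The halting configuration of the machine. [folklore] -/
theorem haltList_fmTM (L : List (M₂.Γ M₂.k₁)) :
    haltList (fmTM M₁ M₂ o₁ e₂ o₂ sep) L =
      cfg M₁ M₂ B C none M₁.initialState M₂.initialState none none
        (fun _ => []) (update (fun _ => []) M₂.k₁ L) [] [] := by
  rw [haltList_eq]
  change (⟨none, (M₁.initialState, M₂.initialState, none, none),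
      update (fun j => ([] : List (FMΓ M₁.Γ M₂.Γ B C j))) (Sum.inl (Sum.inr M₂.k₁)) L⟩ :
      ACfg M₁ M₂ B C) = _
  rw [← mkStk_bot, mkStk_update_inl_inr]
  rfl

/-- **The whole run, unbundled form.** If `M₁` maps `x` to the list word of `bs` within `m₁`
steps, `M₂` maps each `w b` to `y b` within `m b` steps, and no `w b` contains `sep`, then the
machine maps `x` to the concatenation `bs.flatMap y` within
`m₁ + loopCost bs + |bs.flatMap y| + 3` steps.
[cite: AroraBarak2009, §1.3 (multi-tape machine constructions; subroutines)] -/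
theorem fmTM_run (x : List (M₁.Γ M₁.k₀)) (bs : List β) (m₁ : ℕ) (hw : ∀ b, sep ∉ w b)
    (h₁ : ReachesIn M₁.step (initList M₁ x) (haltList M₁ ((listWord sep w bs).map o₁.symm)) m₁)
    (hy : ∀ b, ReachesIn M₂.step (initList M₂ ((w b).map e₂.symm))
      (haltList M₂ ((y b).map o₂.symm)) (m b)) :
    ReachesIn (fmTM M₁ M₂ o₁ e₂ o₂ sep).step (initList (fmTM M₁ M₂ o₁ e₂ o₂ sep) x)
      (haltList (fmTM M₁ M₂ o₁ e₂ o₂ sep) ((bs.flatMap y).map o₂.symm))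
      (m₁ + loopCost w y m bs + (bs.flatMap y).length + 3) := by
  obtain ⟨n₁, hn₁, r₁⟩ := h₁
  rw [initList_fmTM, haltList_fmTM]
  have s1 : ReachesIn (C := ACfg M₁ M₂ B C) (fmTM M₁ M₂ o₁ e₂ o₂ sep).step _ _ n₁ :=
    ⟨n₁, le_rfl, run₁ M₁ M₂ o₁ e₂ o₂ sep M₂.initialState none none (fun _ => []) [] [] r₁⟩
  have s2 := loop_run M₁ M₂ o₁ e₂ o₂ sep w y m hw hy bs []
  have s3 := fin_run M₁ M₂ o₁ e₂ o₂ sep M₁.initialState M₂.initialState (fun _ => [])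
    (fun _ => []) [] (bs.flatMap y).reverse []
  rw [update_bot_nil (G := M₁.Γ) M₁.k₁] at s2
  simp only [List.append_nil] at s2
  simp only [List.append_nil, List.reverse_reverse, List.length_reverse] at s3
  have := ((s1.mono hn₁).trans s2).trans s3
  refine this.mono ?_
  omega

end Main

end Bundled

end Literature.Computability.Complexity.TM2FlatMap

/-! ### The bundled machine and its running time -/

namespace Turing.TM2ComputableAux

open Literature.Computability.Complexity Literature.Computability.Complexity.TM2FlatMap Literature.Computability.Complexity.TM2Iter

variable {Γ₀ Γ₁ Γ₂ : Type}

/-- The machine running the transducer `M₂ : TM2ComputableAux Γ₁ Γ₂` on every `sep`-terminated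
entry of the output of `M₁ : TM2ComputableAux Γ₀ Γ₁` and concatenating the outputs
(`TM2FlatMap.fmTM` with `B = Γ₁`, `C = Γ₂`, equality with `sep` decided classically). A
deliberate dot-notation extension of Mathlib's `Turing.TM2ComputableAux`.
[cite: AroraBarak2009, §1.3 (multi-tape machine constructions; subroutines)] -/
noncomputable def flatMapMachine [Inhabited Γ₁] [Inhabited Γ₂] [Fintype Γ₂]
    (M₁ : TM2ComputableAux Γ₀ Γ₁) (M₂ : TM2ComputableAux Γ₁ Γ₂) (sep : Γ₁) :
    TM2ComputableAux Γ₀ Γ₂ :=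
  letI := Classical.decEq Γ₁
  ⟨fmTM M₁.tm M₂.tm M₁.outputAlphabet M₂.inputAlphabet M₂.outputAlphabet sep, M₁.inputAlphabet,
    M₂.outputAlphabet⟩

/-- **A transducer over a computed list, outputs concatenated, with additive running time.** If
`M₁` maps `l` to the `sep`-terminated concatenation of the words `w b` (`b ∈ bs`, no `w b`
containing `sep`) within `m₁` steps, and `M₂` maps each `w b` to the word `y b` within `m b`
steps, then `M₁.flatMapMachine M₂ sep` maps `l` to `bs.flatMap y` within
`m₁ + Σ_{b ∈ bs} (m b + 2 |w b| + 2 |y b| + 3) + 3` steps.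
[cite: AroraBarak2009, §1.3 (multi-tape machine constructions; subroutines)] -/
theorem flatMap_outputsWithin [Inhabited Γ₁] [Inhabited Γ₂] [Fintype Γ₂]
    (M₁ : TM2ComputableAux Γ₀ Γ₁) (M₂ : TM2ComputableAux Γ₁ Γ₂) {sep : Γ₁} {β : Type}
    {w : β → List Γ₁} {y : β → List Γ₂} {m : β → ℕ} (hw : ∀ b, sep ∉ w b) {l : List Γ₀}
    {bs : List β} {m₁ : ℕ}
    (h₁ : M₁.OutputsWithin l (bs.flatMap fun b => w b ++ [sep]) m₁)
    (h₂ : ∀ b, M₂.OutputsWithin (w b) (y b) (m b)) :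
    (M₁.flatMapMachine M₂ sep).OutputsWithin l (bs.flatMap y)
      (m₁ + (bs.map fun b => m b + 2 * (w b).length + 2 * (y b).length + 3).sum + 3) := by
  letI := Classical.decEq Γ₁
  have r₁ := reachesIn_of_outputsWithin M₁ h₁
  have r₂ := fun b => reachesIn_of_outputsWithin M₂ (h₂ b)
  apply outputsWithin_of_reachesIn
  have h := fmTM_run M₁.tm M₂.tm M₁.outputAlphabet M₂.inputAlphabet M₂.outputAlphabet sep w y m
    (l.map M₁.inputAlphabet.symm) bs m₁ hw r₁ r₂
  have hle := loopCost_add_length_le w y m bs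
  exact h.mono (by omega)

end Turing.TM2ComputableAux
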